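import Summits.QuantumAdvantage.QuantumAdvantage.Theorems.NearExactIsExact.Negative.FrameSixCylinder
import Summits.QuantumAdvantage.QuantumAdvantage.Theorems.NearExactIsExact.Negative.IsolatingFlat

/-!
# `NearExactIsExact` (stmt-QuantumAdvantage-14043) — negative side: **a cylinder residual over a 5-bit block obeys BQQ**
(disprover gen 38, DISPROOF §46; COROLLARY 1 of THEOREM CYL6, now kernel-checked)

Setting of `TriangularBqqFive` (gen 36): `π, τ` mutually inverse coordinatewise-quadratic maps of `𝔽₂^{k+5}` preserving
the first `k` coordinates, `c₁, c₂` cubic, residual `R = c₁ ⊕ c₂∘π` with slices `R_t` on `𝔽₂⁵`.  Its theorem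
`bqq_triangular_five_or_cylinder` ends in a third alternative, the CYLINDER (every slice empty or full).  Here:

* `bqq_of_cylinder` — if every slice is empty or full then `R ≡ 0` or `2·wt(R) ≥ 2^{k+1}` (i.e. `wt(R) ≥ 2^{m−5}`,
  `m = k + 5`): BQQ.  Proof: `N` = full slices; if `0 < |N|` and `64·|N| < 2^{k+1}`, `IsolatingFlat.exists_affine_isolating`
  (j = 6) gives an affinely parametrised 6-flat of the frame meeting `N` exactly in its centre, and
  `FrameSixCylinder.cylinder_window_false` (D2 + polar form + THEOREM CYL6) refutes that window; otherwise
  `2·wt(R) = 64·|N| ≥ 2^{k+1}`.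

With `bqq_triangular_five_or_cylinder` (pending tree build) this is THEOREM BQQ^tri₅ in full: every frame-preserving
biquadratic permutation with a nonlinear block of `≤ 5` bits — equivalently every biquadratic permutation of `𝔽₂^m` with
`≥ m − 5` independent affine components — satisfies BQQ(m), for every `m`; the two-line assembly is left to the file that
can import both.
HONEST FRAMING: kernel-checked structure theorem on the NEGATIVE side of the crux; no Theses statement asserted or refuted;
standard axioms; NOT summit progress.
-/

set_option linter.dupNamespace false -- D-0017: single-problem summit ⇒ `QuantumAdvantage.QuantumAdvantage` by design

namespace Summit.QuantumAdvantage.QuantumAdvantage.Theorems.NearExactIsExact.Negative.CylinderWindowBqq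

open Finset
open Literature.Computability.QuantumComplexity
open Summit.QuantumAdvantage.QuantumAdvantage.Theorems.NearExactIsExact.Negative.ProjectionConcat (card_filter_append)
open Summit.QuantumAdvantage.QuantumAdvantage.Theorems.NearExactIsExact.Negative.IsolatingFlat (exists_affine_isolating)
open Summit.QuantumAdvantage.QuantumAdvantage.Theorems.NearExactIsExact.Negative.FrameSixCylinder (cylinder_window_false)

variable {k : ℕ}

/-- **Cylinder ⇒ BQQ (5-bit block, every frame size).**  `π, τ` mutually inverse coordinatewise-quadratic maps of
`𝔽₂^{k+5}`, `π` preserving the first `k` coordinates, `c₁, c₂` cubic; if every slice of `R = c₁ ⊕ c₂∘π` over the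
frame is empty or full, then `R ≡ 0` or `2·wt(R) ≥ 2^{k+1}`. [folklore] -/
theorem bqq_of_cylinder (π τ : (Fin (k + 5) → Bool) → (Fin (k + 5) → Bool))
    (hπ : ∀ i, IsDegLeFun 2 (fun z => π z i)) (hτ : ∀ i, IsDegLeFun 2 (fun z => τ z i))
    (hτπ : ∀ z, τ (π z) = z) (hpres : ∀ z (i : Fin k), π z (Fin.castAdd 5 i) = z (Fin.castAdd 5 i))
    (c₁ c₂ : (Fin (k + 5) → Bool) → Bool) (h₁ : IsDegLeFun 3 c₁) (h₂ : IsDegLeFun 3 c₂)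
    (hcyl : ∀ t : Fin k → Bool,
      #(univ.filter fun y : Fin 5 → Bool => (c₁ (Fin.append t y) ^^ c₂ (π (Fin.append t y))) = true) = 0 ∨
      #(univ.filter fun y : Fin 5 → Bool => (c₁ (Fin.append t y) ^^ c₂ (π (Fin.append t y))) = true) = 32) :
    (∀ z, c₁ z = c₂ (π z)) ∨
      2 ^ (k + 1) ≤ 2 * #(univ.filter fun z : Fin (k + 5) → Bool => (c₁ z ^^ c₂ (π z)) = true) := by
  classical
  set w : (Fin k → Bool) → ℕ := fun t =>
    #(univ.filter fun y : Fin 5 → Bool => (c₁ (Fin.append t y) ^^ c₂ (π (Fin.append t y))) = true) with hw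
  have htot : #(univ.filter fun z : Fin (k + 5) → Bool => (c₁ z ^^ c₂ (π z)) = true) = ∑ t, w t :=
    card_filter_append (n₁ := k) (n₂ := 5) _
  set N : Finset (Fin k → Bool) := univ.filter fun t => w t ≠ 0 with hN
  have hsumN : ∑ t ∈ N, w t = ∑ t, w t := sum_filter_ne_zero _
  have hzero : ∀ t, t ∉ N → w t = 0 := fun t ht => by
    by_contra h
    exact ht (mem_filter.2 ⟨mem_univ _, h⟩)
  have hfull : ∀ t ∈ N, w t = 32 := fun t ht => (hcyl t).resolve_left (mem_filter.1 ht).2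
  by_cases hNe : N = ∅
  · left
    intro z
    have hz : w (fun i => z (Fin.castAdd 5 i)) = 0 := by
      refine hzero _ ?_
      rw [hNe]
      simp
    have hz' := filter_eq_empty_iff.1 (card_eq_zero.1 hz) (mem_univ (fun i => z (Fin.natAdd k i)))
    rw [Fin.append_castAdd_natAdd] at hz'
    revert hz'
    cases c₁ z <;> cases c₂ (π z) <;> simp
  · right
    obtain ⟨t₀, ht₀⟩ := nonempty_iff_ne_empty.2 hNe
    -- the isolation step: `64·|N| ≥ 2^{k+1}`
    have hkey : 2 ^ (k + 1) ≤ #N * 2 ^ 6 := by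
      by_contra hlt
      obtain ⟨φ, hφ, hφ0, hφN⟩ := exists_affine_isolating N t₀ 6 (not_le.1 hlt)
      refine cylinder_window_false π τ hπ hτ hτπ hpres c₁ c₂ h₁ h₂ φ hφ (fun s y => ?_)
      by_cases hs : s = fun _ => false
      · subst hs
        rw [hφ0]
        have huniv : (univ.filter fun y : Fin 5 → Bool =>
            (c₁ (Fin.append t₀ y) ^^ c₂ (π (Fin.append t₀ y))) = true) = univ := by
          apply eq_univ_of_card
          have h32 : #(univ.filter fun y : Fin 5 → Bool =>
              (c₁ (Fin.append t₀ y) ^^ c₂ (π (Fin.append t₀ y))) = true) = 32 := hfull t₀ ht₀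
          rw [h32, Fintype.card_fun, Fintype.card_bool, Fintype.card_fin]
          norm_num
        have hy := (mem_filter.1 ((eq_univ_iff_forall.1 huniv) y)).2
        rw [hy]
        simp
      · have h0 : w (φ s) = 0 := hzero _ (hφN s hs)
        have hy := filter_eq_empty_iff.1 (card_eq_zero.1 h0) (mem_univ y)
        have hdec : decide (∀ i, s i = false) = false := by
          rw [decide_eq_false_iff_not]
          exact fun h => hs (funext h)
        rw [hdec]
        revert hy
        cases (c₁ (Fin.append (φ s) y) ^^ c₂ (π (Fin.append (φ s) y))) <;> simp
    rw [htot, ← hsumN, sum_congr rfl hfull, sum_const, smul_eq_mul]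
    calc 2 ^ (k + 1) ≤ #N * 2 ^ 6 := hkey
      _ = 2 * (#N * 32) := by ring

end Summit.QuantumAdvantage.QuantumAdvantage.Theorems.NearExactIsExact.Negative.CylinderWindowBqq
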